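import Literature.MathematicalPhysics.QuantumFieldTheory.Balaban1983to89.BalabanUVClass
import Literature.MathematicalPhysics.QuantumFieldTheory.Balaban1983to89.T3UnitScaleTilt
import HarnessLib

/-!
# `Balaban1983to89.BalabanAdmissibleClassParams` — ADMISSIBLE CLASS-PARAMETER SCHEDULES for Bałaban's UV class on the
# d = 3 torus families (`BalabanUVClass.ClassParams` along a trajectory `j ↦ prm j`, height `j` = lattice spacing `L^{-j}`)

Work item `defn-BalabanAdmissibleClassParams` (kind definition; requested by `planner-ym-r3-idea-1-g6-0` for
stmt-QuantumFields-27679 `OneStepBackwardContraction`, now re-typed as stmt-QuantumFields-27939, route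
`BackwardLiouvilleRigidity`).  The request: «a predicate `AdmissibleClassParams (F : T3Family) (γ b₀ p₀ : ℝ)
(prm : ℕ → BalabanUVClass.ClassParams) : Prop` recording the printed height-dependence of every «O(1)» of `ClassParams` along a
trajectory … PURPOSE: the crux quantifies over arbitrary schedules `prm`; with degenerate parameters (δ < 0, cLF = 0, …)
`MemAtHeight` is nearly vacuous, so if a refuter defeats 27679 through the degenerate class the announced repair is
`27679R := AdmissibleClassParams F γ b₀ p₀ prm → (body of 27679)`, with `ClassLimitTrajectories` strengthened to produce an admissible
schedule».

## What this file is

ONE `structure … : Prop` WITH A BODY, `AdmissibleClassParams F γ b₀ p₀ prm`, one field per field of `BalabanUVClass.ClassParams`,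
each the PRINTED dependence of that «O(1)» on the height `j` through Bałaban's running coupling and thresholds
(`g_j = √(γL^{-j})`, `p(g) = b₀(1 + log g⁻¹)^{p₀}`, `θ(j) = g_j p(g_j)` = tree `T3UnitScaleTilt.θBal F.L γ b₀ p₀ j`;
[Balaban1985UV3] p.256 «g_k = g(Lᵏε)^{1/2}», (7) p.257):

* `window`: the all-small window is the canonical one with margin, `δ_j ≥ 2θ(j)` ((47) p.267 «the characteristic function χ_k
  corresponds to the restrictions … |U_k(∂p) − 1| < g_kp(g_k)η²»; p.267 «the decomposition of unity (7) for the field V … with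
  ε₁ = g_kp(g_k)»; the factor 2 is the requester's margin over the window `PlaqSmall (θBal … j)` read by the crux — print's `b₀` is a
  free «sufficiently large» constant (7) p.257 and `θ` is linear in `b₀`, `T3InteriorExcision.θBal_mul`);
* `regular`: the regular window of the fine background is positive and bounded uniformly in `j` ([Balaban1985Variational] Thm 1 p.279: the
  minimal orbit lies in `𝔘_k({Ω_j}, B₃ε₁)` and is the unique critical orbit in `𝔘_k({Ω_j}, ε₀)` for `B₃ε₁ ≤ ε₀ ≤ a₀`, `a₀ = a₀(d, L)`;
  [Balaban1985UV3] (68) p.273 «|U_k(∂p) − 1| < O(1)g_jp(g_j)L^{-2j}»);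
* `largeThreshold`: the large-plaquette threshold is of order `θ(j)` and not above the window, `δL_j ≤ 2θ(j)` ((67) p.273 «a plaquette
  p′ ⊂ Λ_j and such that |V_j(∂p′) − 1| ≥ g_jp(g_j)»), so that every top-level plaquette is either inside the representation window or
  carries a large-field small factor;
* `beta`: the coefficient of the fine Wilson action of the background is the bare one of the run carrying the witness,
  `β = 1/(g²ε)` ((5) p.256, (41) p.266 «exp[−(1/g_k²)A^η(U_k) …]» with `A^η = η^{-1}·A`), i.e. `L^K/γ` on run `K` of the family in the
  tree's units (`T3Family.scheme … .β K = (γε_K)⁻¹`, `T3FinestHeightTail.beta_mul_θBal_sq`); `MemAtHeight F ℰ j prm r` chooses the run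
  `K ≥ j` existentially, so along a schedule the printed constraint expressible on `prm j` alone is `β_j ≥ L^j/γ = 1/g_j²` (equality iff
  the witness run is `K = j`) — see «READING» below;
* `decay`, `diam`: `κ_j ≥ κ₀ > 0` and `M_j ≤ M₀` uniformly ((25) p.262 «κ can be arbitrarily large if M₁ is sufficiently large»; p.263
  «The localization domain X is contained in a cube □ of the size RM₁»);
* `cover`: the per-site activity budget is `≤ C₀·g_j²p(g_j)² = C₀θ(j)²` ((45)–(46) p.267 «Σ_{Y_j: y = y₀}|𝒫_j(Y_j, U_k)| ≤
  O(1)(O(M₁³)g_{k−1}p(g_{k−1}))²(Lʲη)⁴ … Σ_jΣ_{Y_j}|𝒫_j(Y_j, U_k)| ≤ O(1)M₁⁶g²_{k−1}p²(g_{k−1})|Λ_k|. Thus the sum is not only convergent, but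
  also small»; `g_{k−1} = L^{-1/2}g_k`, `p(g_{k−1}) ≤ (1 + ½log L)^{p₀}p(g_k)`, constants absorbed in `C₀`);
* `vacuum`: `cE_j ≤ C₀` ((65) p.273 «|E_k| ≤ O(1)|T₁^{(k)}|»);
* `slack`: the `V`-independent remainder of (41)/(47), «Σ_{j=0}^{k−1} O((Lʲε)^{3+κ₀})|T₁^{(j)}|» with `κ₀ > 0`, summed in the tree's units
  on run `K` at height `j` (level `k = K − j`; `|T^{(i)}| = 8L^{3(m+K−i)}` sites, `(Lⁱε_K)^{3+κ₀}|T^{(i)}| = 8L^{3m}·L^{(i−K)κ₀}`):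
  `≤ 8L^{3m}(L^{κ₀} − 1)^{-1}·L^{-jκ₀}` — a geometric bound `slack_j ≤ S₀q^j`, `0 ≤ q < 1`, uniform in the cutoff, hence bounded
  uniformly in `j` (`AdmissibleClassParams.slack_le_const`);
* `largeField`: the large-field exponent per large plaquette is at least `¼p(g_j)²` ((71) p.273 «the corresponding part of the
  exponential gives the small factor exp(−¼p²(g_j))»); in the tree's units `p(g_j)² = (L^j/γ)·θ(j)²` (`pFun_sq_eq`);
* `stability`: `c5_j ≤ C₀` ((5) p.256 and p.257 «the constant O(1) is independent of ε, k, g_k in a bounded set»; here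
  `g_j ∈ (0, √γ]`).

API (all proved, no content of Bałaban's series): positivity consequences (`delta_pos`, `beta_pos`, `kappa_pos`, `cLF_nonneg`),
the uniform slack bound, monotonicity `of_stronger` (a schedule of STRONGER parameters — `(prm' j).Weaker (prm j)` for every `j` — is
again admissible), the identity `pFun_sq_eq`, and NON-VACUITY: the printed schedule `printedSchedule F γ b₀ p₀ κ₀ M₀ C₀ R₀` (every field AT
its printed value) is admissible for `0 < κ₀`, `0 < R₀` (`printedSchedule_admissible`).  The alias `BalabanAdmissibleClassParams` (parent
namespace) is the work item's notion name.

## READING / what this file is NOT (honest framing)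

* NOTHING is asserted about any density: `AdmissibleClassParams` constrains PARAMETERS only; that Bałaban's height densities are members
  with an admissible schedule is [Balaban1985UV3] Thm 2 p.272 + Sect. D for his averaging and a ROUTE obligation for the cell's `ℰp`
  (`BalabanUVClass` header), not typed here (D-0026: no named fact in this file).
* `beta` (READING, flagged): the request's wording is «β = L^j/γ in the tree's units».  In `BalabanUVClass.Witness` the term
  `prm.β * wilsonAction4 (bg V)` is the UNIT-WEIGHT Wilson action of the background on the FINEST lattice `T_{ε_K}` of the witness run `K`
  (`MemOfRun`: «the background lives on run K's finest lattice»), whose printed coefficient is `1/(g²ε_K) = L^K/γ` (the class file's own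
  docstring of `β`: «in d = 3 = 1/(g²ε)»), `= L^j/γ` exactly when `K = j`.  Since `MemAtHeight` quantifies the run existentially, the
  faithful constraint on the schedule is the lower bound `L^j/γ ≤ β_j` (every run `K ≥ j` satisfies it, `L > 1`); pinning `β_j = L^j/γ`
  would restrict witnesses to the run `K = j` (zero renormalization steps, `bg V = V`), which is not the printed representation (41)/(47).
  The printed schedule `printedSchedule` takes the requested value `L^j/γ`, which is admissible.
* `regular` (READING, flagged): the request says «fixed regular window δreg»; print's regular window of the fine background,
  «|U_k(∂p) − 1| < O(1)g_jp(g_j)L^{-2j}» (68) / `ε₀η²` in [Balaban1985Variational] (2), depends on the number `K − j` of steps below the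
  height in the tree's (unrescaled, group-valued) units, so only `0 < δreg_j ≤ R₀` is recorded; a constant schedule (as in
  `printedSchedule`) is admissible.
* The exponent `κ₀` of the slack and the constants `O(1)`, `M₁`, `R₁`, `B₃`, `a₀` are existential reals here, never computed; dependences
  on `(L, m, γ, b₀, p₀)` are allowed (the existentials sit inside the predicate, whose parameters these are).
* No `instance`, no notation, no named fact; imports `BalabanUVClass` (the class) and `T3UnitScaleTilt` (`θBal`), nothing else.

References (pages read on the held texts `paper:balaban1985-cmp102-uv-stability-3d` pp.256–257, 262–263, 266–267, 273–274 and
`paper:balaban1985-cmp102-variational-background` pp.278–279): T. Bałaban, CMP **102** (1985) 255–275 [Balaban1985UV3]; CMP **102** (1985)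
277–309 [Balaban1985Variational]; CMP **109** (1987) 249–301 [Balaban1987RG1] ((0.21)–(0.26) pp.256–258, the same clauses in the
small-field paper).
-/

noncomputable section

open Literature.MathematicalPhysics.QuantumFieldTheory
open Literature.MathematicalPhysics.QuantumFieldTheory.Balaban1983to89.T3ContinuumYM3Torus
open Literature.MathematicalPhysics.QuantumFieldTheory.Balaban1983to89.T3UnitScaleTilt

namespace Literature.MathematicalPhysics.QuantumFieldTheory.Balaban1983to89.BalabanUVClass

/-- **ADMISSIBLE CLASS-PARAMETER SCHEDULE** along the heights `j = 0, 1, 2, …` (lattice spacing `L^{-j}`) of the `d = 3` torus family `F`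
at unit-lattice coupling `γ` and threshold profile `(b₀, p₀)`: every «O(1)» of `BalabanUVClass.ClassParams` obeys its PRINTED dependence
on the height through `g_j = √(γL^{-j})`, `p(g) = b₀(1 + log g⁻¹)^{p₀}`, `θ(j) = g_jp(g_j)` (`θBal F.L γ b₀ p₀ j`): window `δ_j ≥ 2θ(j)`
((47) p.267, margin 2 over the consumer's window), regular window positive and bounded ([Balaban1985Variational] Thm 1 p.279, (68) p.273),
large threshold `δL_j ≤ 2θ(j)` ((67) p.273), background coefficient `β_j ≥ L^j/γ = 1/g_j²` (`= L^K/γ = 1/(g²ε_K)` on the witness run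
`K ≥ j`, (5) p.256/(41) p.266; module header «READING»), decay rate `κ_j ≥ κ₀ > 0` ((25) p.262), diameter constant `M_j ≤ M₀` (p.263),
per-site activity budget `Ccov_j ≤ C₀θ(j)²` ((45)–(46) p.267), vacuum-energy constant `cE_j ≤ C₀` ((65) p.273), slack `≤ S₀q^j`,
`0 ≤ q < 1` (the remainder «Σ_{i<k} O((Lⁱε)^{3+κ₀})|T₁^{(i)}|» of (41)/(47) summed in the tree's units), large-field exponent
`cLF_j ≥ ¼p(g_j)²` ((71) p.273), stability constant `c5_j ≤ C₀` ((5) pp.256–257).  A predicate on PARAMETERS; nothing about densities.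
[cite: Balaban1985UV3, (5) p.256, (7) p.257, (25) p.262, (41) p.266, (45)-(47) p.267, (65)-(71) p.273] -/
structure AdmissibleClassParams (F : T3Family) (γ b₀ p₀ : ℝ) (prm : ℕ → ClassParams) : Prop where
  /-- THE ALL-SMALL WINDOW IS THE CANONICAL ONE WITH MARGIN: `2θ(j) ≤ δ_j` ((47) p.267 «χ_k corresponds to the restrictions …
  |U_k(∂p) − 1| < g_kp(g_k)η²»; p.267 «ε₁ = g_kp(g_k)»). -/
  window : ∀ j, 2 * θBal F.L γ b₀ p₀ j ≤ (prm j).δ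
  /-- THE REGULAR WINDOW OF THE FINE BACKGROUND IS POSITIVE AND BOUNDED uniformly in the height ([Balaban1985Variational] Thm 1 p.279:
  `𝔘_k({Ω_j}, B₃ε₁) ⊆ 𝔘_k({Ω_j}, ε₀)`, `B₃ε₁ ≤ ε₀ ≤ a₀(d, L)`; [Balaban1985UV3] (68) p.273). -/
  regular : ∃ R₀ : ℝ, ∀ j, 0 < (prm j).δreg ∧ (prm j).δreg ≤ R₀
  /-- THE LARGE-PLAQUETTE THRESHOLD IS OF ORDER `θ(j)` AND NOT ABOVE THE WINDOW: `δL_j ≤ 2θ(j)` ((67) p.273 «|V_j(∂p′) − 1| ≥ g_jp(g_j)»). -/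
  largeThreshold : ∀ j, (prm j).δL ≤ 2 * θBal F.L γ b₀ p₀ j
  /-- THE BACKGROUND COEFFICIENT IS AT LEAST THE HEIGHT-`j` BARE COEFFICIENT: `L^j/γ = 1/g_j² ≤ β_j` (print: `β = 1/(g²ε_K) = L^K/γ` on the
  witness run `K ≥ j`; (5) p.256, (41) p.266; equality iff `K = j` — module header «READING»). -/
  beta : ∀ j, (F.L : ℝ) ^ j / γ ≤ (prm j).β
  /-- THE DECAY RATE IS BOUNDED BELOW: `0 < κ₀ ≤ κ_j` ((25) p.262 «κ can be arbitrarily large if M₁ is sufficiently large»). -/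
  decay : ∃ κ₀ : ℝ, 0 < κ₀ ∧ ∀ j, κ₀ ≤ (prm j).κ
  /-- THE FOOTPRINT-DIAMETER CONSTANT IS BOUNDED: `M_j ≤ M₀` (p.263 «X is contained in a cube □ of the size RM₁», big blocks of size `M₁`). -/
  diam : ∃ M₀ : ℝ, ∀ j, (prm j).M ≤ M₀
  /-- THE PER-SITE ACTIVITY BUDGET IS `O(g_j²p(g_j)²) = O(θ(j)²)`: `Ccov_j ≤ C₀θ(j)²` ((45)–(46) p.267 «≤ O(1)M₁⁶g²_{k−1}p²(g_{k−1})|Λ_k|.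
  Thus the sum is not only convergent, but also small»). -/
  cover : ∃ C₀ : ℝ, ∀ j, (prm j).Ccov ≤ C₀ * θBal F.L γ b₀ p₀ j ^ 2
  /-- THE PER-SITE VACUUM-ENERGY CONSTANT IS BOUNDED: `cE_j ≤ C₀` ((65) p.273 «|E_k| ≤ O(1)|T₁^{(k)}|»). -/
  vacuum : ∃ C₀ : ℝ, ∀ j, (prm j).cE ≤ C₀
  /-- THE SLACK DECAYS GEOMETRICALLY IN THE HEIGHT, uniformly in the cutoff: `slack_j ≤ S₀q^j`, `0 ≤ q < 1` (the remainder
  «Σ_{i=0}^{k−1} O((Lⁱε)^{3+κ₀})|T₁^{(i)}|» of (41) p.266 / (47) p.267 on run `K` at height `j`: `≤ 8L^{3m}(L^{κ₀} − 1)^{-1}L^{-jκ₀}`). -/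
  slack : ∃ S₀ q : ℝ, 0 ≤ q ∧ q < 1 ∧ ∀ j, (prm j).slack ≤ S₀ * q ^ j
  /-- THE LARGE-FIELD EXPONENT PER LARGE PLAQUETTE IS AT LEAST `¼p(g_j)²` ((71) p.273 «the small factor exp(−¼p²(g_j))»). -/
  largeField : ∀ j, B10.pFun b₀ p₀ (Real.sqrt (γ * ((F.L : ℝ)⁻¹) ^ j)) ^ 2 / 4 ≤ (prm j).cLF
  /-- THE STABILITY CONSTANT OF (5) IS UNIFORM: `c5_j ≤ C₀` ((5) p.256; p.257 «the constant O(1) is independent of ε, k, g_k in a bounded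
  set»). -/
  stability : ∃ C₀ : ℝ, ∀ j, (prm j).c5 ≤ C₀

namespace AdmissibleClassParams

variable {F : T3Family} {γ b₀ p₀ : ℝ} {prm prm' : ℕ → ClassParams}

/-- `θ(j) > 0` for `0 < γ ≤ 1`, `0 < b₀` (tree: `T3MinimiserStabilityReduction.θBal_pos`, outside this file's import cone — re-proved in
five lines rather than importing the descent tower). [cite: Balaban1985UV3, (7) p.257] -/
private theorem θBal_pos' (F : T3Family) (hγ : 0 < γ) (hγ1 : γ ≤ 1) (hb : 0 < b₀) (p₀ : ℝ) (j : ℕ) :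
    0 < θBal F.L γ b₀ p₀ j := by
  have hL : (1 : ℝ) ≤ F.L := by exact_mod_cast F.hL.2.le
  have hLj : 0 < ((F.L : ℝ)⁻¹) ^ j := pow_pos (inv_pos.mpr (by linarith)) j
  have hLj1 : ((F.L : ℝ)⁻¹) ^ j ≤ 1 := pow_le_one₀ (inv_nonneg.mpr (by linarith)) (inv_le_one_of_one_le₀ hL)
  have hx : 0 < γ * ((F.L : ℝ)⁻¹) ^ j := mul_pos hγ hLj
  have hx1 : γ * ((F.L : ℝ)⁻¹) ^ j ≤ 1 := by nlinarith
  have hs : 0 < Real.sqrt (γ * ((F.L : ℝ)⁻¹) ^ j) := Real.sqrt_pos.mpr hx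
  have hs1 : Real.sqrt (γ * ((F.L : ℝ)⁻¹) ^ j) ≤ 1 := Real.sqrt_le_one.mpr hx1
  refine mul_pos hs ?_
  unfold B10.pFun
  have hlog : 0 ≤ Real.log (Real.sqrt (γ * ((F.L : ℝ)⁻¹) ^ j))⁻¹ := Real.log_nonneg (one_le_inv_iff₀.mpr ⟨hs, hs1⟩)
  exact mul_pos hb (Real.rpow_pos_of_pos (by linarith) _)

/-- The all-small windows of an admissible schedule are non-degenerate: `0 < δ_j` (`0 < γ ≤ 1`, `0 < b₀`). [cite: Balaban1985UV3, (7) p.257 and (47) p.267] -/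
theorem delta_pos (h : AdmissibleClassParams F γ b₀ p₀ prm) (hγ : 0 < γ) (hγ1 : γ ≤ 1) (hb : 0 < b₀) (j : ℕ) : 0 < (prm j).δ :=
  lt_of_lt_of_le (by have := θBal_pos' F hγ hγ1 hb p₀ j; linarith) (h.window j)

/-- The background coefficients of an admissible schedule are positive: `0 < β_j` (`0 < γ`). [cite: Balaban1985UV3, (5) p.256] -/
theorem beta_pos (h : AdmissibleClassParams F γ b₀ p₀ prm) (hγ : 0 < γ) (j : ℕ) : 0 < (prm j).β := by
  have hL : (0 : ℝ) < F.L := by exact_mod_cast lt_trans zero_lt_one F.hL.2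
  exact lt_of_lt_of_le (div_pos (pow_pos hL j) hγ) (h.beta j)

/-- The decay rates of an admissible schedule are positive: `0 < κ_j`. [cite: Balaban1985UV3, (25) p.262] -/
theorem kappa_pos (h : AdmissibleClassParams F γ b₀ p₀ prm) (j : ℕ) : 0 < (prm j).κ := by
  obtain ⟨κ₀, hκ₀, hκ⟩ := h.decay
  exact lt_of_lt_of_le hκ₀ (hκ j)

/-- The large-field exponents of an admissible schedule are non-negative: `0 ≤ cLF_j`. [cite: Balaban1985UV3, (71) p.273] -/
theorem cLF_nonneg (h : AdmissibleClassParams F γ b₀ p₀ prm) (j : ℕ) : 0 ≤ (prm j).cLF :=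
  le_trans (div_nonneg (sq_nonneg _) (by norm_num)) (h.largeField j)

/-- The regular windows of an admissible schedule are positive: `0 < δreg_j`. [cite: Balaban1985Variational, Thm 1 p.279] -/
theorem deltaReg_pos (h : AdmissibleClassParams F γ b₀ p₀ prm) (j : ℕ) : 0 < (prm j).δreg := by
  obtain ⟨R₀, hR⟩ := h.regular
  exact (hR j).1

/-- THE SLACK IS BOUNDED UNIFORMLY IN THE HEIGHT (the requester's «bounded uniformly»; from the geometric bound, `q^j ≤ 1`).
[cite: Balaban1985UV3, (41) p.266 and (47) p.267] -/
theorem slack_le_const (h : AdmissibleClassParams F γ b₀ p₀ prm) : ∃ S : ℝ, ∀ j, (prm j).slack ≤ S := by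
  obtain ⟨S₀, q, hq0, hq1, hs⟩ := h.slack
  refine ⟨max S₀ 0, fun j => (hs j).trans ?_⟩
  have hqj : q ^ j ≤ 1 := pow_le_one₀ hq0 hq1.le
  have hqj0 : 0 ≤ q ^ j := pow_nonneg hq0 j
  calc S₀ * q ^ j ≤ max S₀ 0 * q ^ j := mul_le_mul_of_nonneg_right (le_max_left _ _) hqj0
    _ ≤ max S₀ 0 * 1 := mul_le_mul_of_nonneg_left hqj (le_max_right _ _)
    _ = max S₀ 0 := mul_one _

/-- The slack of an admissible schedule tends to zero along the heights (geometric decay). [cite: Balaban1985UV3, (47) p.267] -/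
theorem slack_eventually_le (h : AdmissibleClassParams F γ b₀ p₀ prm) {ε : ℝ} (hε : 0 < ε) :
    ∃ j₀ : ℕ, ∀ j, j₀ ≤ j → (prm j).slack ≤ ε := by
  obtain ⟨S₀, q, hq0, hq1, hs⟩ := h.slack
  have ht : Filter.Tendsto (fun j : ℕ => max S₀ 0 * q ^ j) Filter.atTop (nhds 0) := by
    simpa using (tendsto_pow_atTop_nhds_zero_of_lt_one hq0 hq1).const_mul (max S₀ 0)
  obtain ⟨j₀, hj₀⟩ := (ht.eventually (ge_mem_nhds hε)).exists_forall_of_atTop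
  refine ⟨j₀, fun j hj => (hs j).trans (le_trans ?_ (hj₀ j hj))⟩
  exact mul_le_mul_of_nonneg_right (le_max_left _ _) (pow_nonneg hq0 j)

/-- **ADMISSIBILITY IS INHERITED BY STRONGER SCHEDULES**: if `prm` is admissible and, at every height, `prm j` is WEAKER than `prm' j`
(`(prm' j).Weaker (prm j)`: larger window, smaller large threshold / diameter constant / budgets / slack / stability constant, larger
large-field exponent, same `β`, `κ`, `δreg`), then `prm'` is admissible. [cite: Balaban1985UV3, (5) pp.256-257] -/
theorem of_stronger (h : AdmissibleClassParams F γ b₀ p₀ prm) (hw : ∀ j, (prm' j).Weaker (prm j)) :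
    AdmissibleClassParams F γ b₀ p₀ prm' where
  window j := (h.window j).trans (hw j).δ_le
  regular := by
    obtain ⟨R₀, hR⟩ := h.regular
    exact ⟨R₀, fun j => by rw [← (hw j).δreg_eq]; exact hR j⟩
  largeThreshold j := ((hw j).δL_le).trans (h.largeThreshold j)
  beta j := (h.beta j).trans_eq (hw j).β_eq
  decay := by
    obtain ⟨κ₀, hκ₀, hκ⟩ := h.decay
    exact ⟨κ₀, hκ₀, fun j => (hκ j).trans_eq (hw j).κ_eq⟩
  diam := by
    obtain ⟨M₀, hM⟩ := h.diam
    exact ⟨M₀, fun j => ((hw j).M_le).trans (hM j)⟩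
  cover := by
    obtain ⟨C₀, hC⟩ := h.cover
    exact ⟨C₀, fun j => ((hw j).Ccov_le).trans (hC j)⟩
  vacuum := by
    obtain ⟨C₀, hC⟩ := h.vacuum
    exact ⟨C₀, fun j => ((hw j).cE_le).trans (hC j)⟩
  slack := by
    obtain ⟨S₀, q, hq0, hq1, hs⟩ := h.slack
    exact ⟨S₀, q, hq0, hq1, fun j => ((hw j).slack_le).trans (hs j)⟩
  largeField j := (h.largeField j).trans (hw j).cLF_le
  stability := by
    obtain ⟨C₀, hC⟩ := h.stability
    exact ⟨C₀, fun j => ((hw j).c5_le).trans (hC j)⟩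

/-- `p(g_j)² = (L^j/γ)·θ(j)²` (`θ(j) = g_jp(g_j)`, `g_j² = γL^{-j}`, `γ > 0`): the large-field exponent `¼p(g_j)²` of (71) in terms of the
height-`j` bare coefficient and threshold (cf. `T3FinestHeightTail.beta_mul_θBal_sq` at the finest height of a run).
[cite: Balaban1985UV3, (7) p.257 and (71) p.273] -/
theorem pFun_sq_eq (F : T3Family) (hγ : 0 < γ) (b₀ p₀ : ℝ) (j : ℕ) :
    B10.pFun b₀ p₀ (Real.sqrt (γ * ((F.L : ℝ)⁻¹) ^ j)) ^ 2 = (F.L : ℝ) ^ j / γ * θBal F.L γ b₀ p₀ j ^ 2 := by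
  have hL : (0 : ℝ) < F.L := by exact_mod_cast lt_trans zero_lt_one F.hL.2
  have hx : 0 < γ * ((F.L : ℝ)⁻¹) ^ j := mul_pos hγ (pow_pos (inv_pos.mpr hL) j)
  rw [θBal, mul_pow, Real.sq_sqrt hx.le, ← mul_assoc]
  have : (F.L : ℝ) ^ j / γ * (γ * ((F.L : ℝ)⁻¹) ^ j) = 1 := by
    rw [inv_pow]; field_simp
  rw [this, one_mul]

/-- The large-field clause in the height-`j` currency: `¼(L^j/γ)θ(j)² ≤ cLF_j` (`γ > 0`). [cite: Balaban1985UV3, (71) p.273] -/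
theorem beta_mul_theta_sq_le_cLF (h : AdmissibleClassParams F γ b₀ p₀ prm) (hγ : 0 < γ) (j : ℕ) :
    (F.L : ℝ) ^ j / γ * θBal F.L γ b₀ p₀ j ^ 2 / 4 ≤ (prm j).cLF := by
  rw [← pFun_sq_eq F hγ b₀ p₀ j]
  exact h.largeField j

end AdmissibleClassParams

/-! ## Non-vacuity: the printed schedule -/

/-- **THE PRINTED SCHEDULE** — every field of `ClassParams` AT its printed value along the heights: window and large threshold `2θ(j)`
(the requester's margin), regular window `R₀`, background coefficient `L^j/γ` (the requester's value; the witness run `K = j` case of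
`1/(g²ε)`), decay rate `κ₀`, diameter constant `M₀`, activity budget `C₀θ(j)²`, vacuum-energy constant `C₀`, slack `C₀L^{-j}` (the
geometric remainder with ratio `1/L`), large-field exponent `¼p(g_j)²`, stability constant `C₀`.  A TEMPLATE for producers of admissible
schedules; nothing is claimed about densities. [cite: Balaban1985UV3, (5) p.256, (7) p.257, (25) p.262, (45)-(47) p.267, (65)-(71) p.273] -/
def printedSchedule (F : T3Family) (γ b₀ p₀ κ₀ M₀ C₀ R₀ : ℝ) (j : ℕ) : ClassParams where
  δ := 2 * θBal F.L γ b₀ p₀ j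
  δreg := R₀
  δL := 2 * θBal F.L γ b₀ p₀ j
  β := (F.L : ℝ) ^ j / γ
  κ := κ₀
  M := M₀
  Ccov := C₀ * θBal F.L γ b₀ p₀ j ^ 2
  cE := C₀
  slack := C₀ * ((F.L : ℝ)⁻¹) ^ j
  cLF := B10.pFun b₀ p₀ (Real.sqrt (γ * ((F.L : ℝ)⁻¹) ^ j)) ^ 2 / 4
  c5 := C₀

/-- **NON-VACUITY**: the printed schedule is admissible (`0 < κ₀`, `0 < R₀`; `1 < L` is part of `T3Family`). [cite: Balaban1985UV3, (5) p.256, (25) p.262, (45)-(47) p.267, (65)-(71) p.273] -/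
theorem printedSchedule_admissible (F : T3Family) (γ b₀ p₀ : ℝ) {κ₀ : ℝ} (hκ₀ : 0 < κ₀) (M₀ C₀ : ℝ) {R₀ : ℝ} (hR₀ : 0 < R₀) :
    AdmissibleClassParams F γ b₀ p₀ (printedSchedule F γ b₀ p₀ κ₀ M₀ C₀ R₀) where
  window _ := le_rfl
  regular := ⟨R₀, fun _ => ⟨hR₀, le_rfl⟩⟩
  largeThreshold _ := le_rfl
  beta _ := le_rfl
  decay := ⟨κ₀, hκ₀, fun _ => le_rfl⟩
  diam := ⟨M₀, fun _ => le_rfl⟩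
  cover := ⟨C₀, fun _ => le_rfl⟩
  vacuum := ⟨C₀, fun _ => le_rfl⟩
  slack := by
    have hL : (1 : ℝ) < F.L := by exact_mod_cast F.hL.2
    refine ⟨C₀, (F.L : ℝ)⁻¹, inv_nonneg.mpr (by linarith), inv_lt_one_of_one_lt₀ hL, fun _ => le_rfl⟩
  largeField _ := le_rfl
  stability := ⟨C₀, fun _ => le_rfl⟩

/-- There is an admissible schedule for every family and every `(γ, b₀, p₀)`. [cite: Balaban1985UV3, (5) pp.256-257] -/
theorem exists_admissibleClassParams (F : T3Family) (γ b₀ p₀ : ℝ) : ∃ prm : ℕ → ClassParams, AdmissibleClassParams F γ b₀ p₀ prm :=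
  ⟨printedSchedule F γ b₀ p₀ 1 0 0 1, printedSchedule_admissible F γ b₀ p₀ one_pos 0 0 one_pos⟩

end Literature.MathematicalPhysics.QuantumFieldTheory.Balaban1983to89.BalabanUVClass

namespace Literature.MathematicalPhysics.QuantumFieldTheory.Balaban1983to89

/-- **Alias under the work item's notion name** (`defn-BalabanAdmissibleClassParams`): `BalabanAdmissibleClassParams F γ b₀ p₀ prm` IS
`BalabanUVClass.AdmissibleClassParams F γ b₀ p₀ prm`. [cite: Balaban1985UV3, (5) p.256, (45)-(47) p.267, (65)-(71) p.273] -/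
abbrev BalabanAdmissibleClassParams (F : T3ContinuumYM3Torus.T3Family) (γ b₀ p₀ : ℝ) (prm : ℕ → BalabanUVClass.ClassParams) : Prop :=
  BalabanUVClass.AdmissibleClassParams F γ b₀ p₀ prm

end Literature.MathematicalPhysics.QuantumFieldTheory.Balaban1983to89

end
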